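import Literature.NumberTheory.ConnesConsani2021.ArchimedeanTraceFormula
import HarnessLib

/-!
# The calculus of approximation numbers (`μ_n`) and of infinitesimals of infinite order — the API behind
# Connes–Consani 2021, App. D Lemma D.1 (47) "`[H, f]` is an infinitesimal of infinite order"

RH-FREE operator-theory bookkeeping (cell `rh-crit`, sub-cell cc, seat t13; bears_on W-C/W-P only through
App. D Lemma 47 = tree fact `CC2021_lemma_D47`, which is OFF the leaf path).  WHAT THIS IS NOT: any claim
about RH; nothing here bears on the truth of RH.  No definition, no named fact (net debt 0): theorems only,
about the tree's `approxNumber` / `IsInfiniteOrder` / `IsTraceClass` (`ArchimedeanTraceFormula.lean`, seat t4).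

Source of the notions: A. Connes, *Noncommutative Geometry* (1994) [bib: `Connes1994`], Chap. IV §2.α
(infinitesimals of order `α`; the inequalities `μ_{n+m}(T₁+T₂) ≤ μ_n(T₁) + μ_m(T₂)`,
`μ_n(ATB) ≤ ‖A‖μ_n(T)‖B‖`, two-sided ideal property), as used in A. Connes, C. Consani, *Weil positivity
and trace formula, the archimedean place*, Selecta Math. 27 (2021) = arXiv:2006.13771 [bib: `ConnesConsani2021`],
App. D p. 33 (arXiv chunk p0033:L20–36: "a compact operator has infinite order when its characteristic
values form a sequence of rapid decay, this implies that it is of trace class"; the proof of Lemma 47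
reduces `[H, f]` to products `P K (1 − P)` and two-sided products with bounded operators).

## What is here (all PROVED)

* `approxNumber_nonneg'`, `approxNumber_le_opNorm`, `approxNumber_le_of_rank_le` (the defining infimum),
  `approxNumber_antitone` (`n ↦ μ_n(T)` is non-increasing);
* `approxNumber_add_le` — `μ_{m+n}(S + T) ≤ μ_m(S) + μ_n(T)`;
* `approxNumber_comp_le` — `μ_n(U T V) ≤ ‖U‖ μ_n(T) ‖V‖` (two-sided ideal inequality), and
  `approxNumber_conj_linearIsometryEquiv` — unitary invariance `μ_n(U T U⁻¹) = μ_n(T)`;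
* `IsInfiniteOrder.add`, `IsInfiniteOrder.comp`, `isInfiniteOrder_zero`, `IsInfiniteOrder.smul`,
  `isInfiniteOrder_of_rank_le` (finite rank), `isInfiniteOrder_conj_iff` (unitary conjugation),
  `IsInfiniteOrder.of_approx` (criterion by explicit finite-rank approximants `‖T − F_n‖ ≤ C_k(n+1)^{−k}`).
-/

noncomputable section

open Filter
open scoped Topology

namespace Literature.NumberTheory.ConnesConsani2021

section ApproxNumberCalculus

variable {𝕜 : Type*} [RCLike 𝕜] {E : Type*} [NormedAddCommGroup E] [NormedSpace 𝕜 E]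

/-- The rank (of the range) of the zero operator is `≤ n`. [folklore] -/
private theorem rank_range_zero_le (n : ℕ) :
    Module.rank 𝕜 (LinearMap.range ((0 : E →L[𝕜] E) : E →ₗ[𝕜] E)) ≤ n := by
  rw [ContinuousLinearMap.toLinearMap_zero, LinearMap.range_zero, rank_bot]
  exact zero_le

/-- The defining set of `μ_n(T)` is nonempty (`F = 0`). [folklore] -/
private theorem approxSet_nonempty (T : E →L[𝕜] E) (n : ℕ) :
    {r : ℝ | ∃ F : E →L[𝕜] E,
      Module.rank 𝕜 (LinearMap.range (F : E →ₗ[𝕜] E)) ≤ n ∧ ‖T - F‖ = r}.Nonempty :=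
  ⟨‖T - 0‖, 0, rank_range_zero_le n, rfl⟩

/-- The defining set of `μ_n(T)` is bounded below by `0`. [folklore] -/
private theorem approxSet_bddBelow (T : E →L[𝕜] E) (n : ℕ) :
    BddBelow {r : ℝ | ∃ F : E →L[𝕜] E,
      Module.rank 𝕜 (LinearMap.range (F : E →ₗ[𝕜] E)) ≤ n ∧ ‖T - F‖ = r} :=
  ⟨0, by rintro r ⟨F, -, rfl⟩; exact norm_nonneg _⟩

/-- RH-FREE. **`μ_n(T) ≤ ‖T − F‖` for every `F` of rank `≤ n`** (the defining infimum).
[cite: Connes1994, Chap. IV §2.α; ConnesConsani2021, App. D p. 33 (arXiv chunk p0033:L20)] -/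
theorem approxNumber_le_of_rank_le (T F : E →L[𝕜] E) {n : ℕ}
    (hF : Module.rank 𝕜 (LinearMap.range (F : E →ₗ[𝕜] E)) ≤ n) :
    approxNumber T n ≤ ‖T - F‖ :=
  csInf_le (approxSet_bddBelow T n) ⟨F, hF, rfl⟩

/-- RH-FREE. `0 ≤ μ_n(T)`. [cite: Connes1994, Chap. IV §2.α] -/
theorem approxNumber_nonneg' (T : E →L[𝕜] E) (n : ℕ) : 0 ≤ approxNumber T n :=
  le_csInf (approxSet_nonempty T n) (by rintro r ⟨F, -, rfl⟩; exact norm_nonneg _)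

/-- RH-FREE. `μ_n(T) ≤ ‖T‖` (`F = 0`). [cite: Connes1994, Chap. IV §2.α] -/
theorem approxNumber_le_opNorm (T : E →L[𝕜] E) (n : ℕ) : approxNumber T n ≤ ‖T‖ := by
  simpa using approxNumber_le_of_rank_le T 0 (rank_range_zero_le n)

/-- RH-FREE. For `ε > 0` there is `F` of rank `≤ n` with `‖T − F‖ < μ_n(T) + ε`. [cite: Connes1994, Chap. IV §2.α] -/
theorem exists_rank_le_norm_sub_lt (T : E →L[𝕜] E) (n : ℕ) {ε : ℝ} (hε : 0 < ε) :
    ∃ F : E →L[𝕜] E, Module.rank 𝕜 (LinearMap.range (F : E →ₗ[𝕜] E)) ≤ n ∧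
      ‖T - F‖ < approxNumber T n + ε := by
  obtain ⟨_, ⟨F, hF, rfl⟩, hlt⟩ :=
    exists_lt_of_csInf_lt (approxSet_nonempty T n) (lt_add_of_pos_right (approxNumber T n) hε)
  exact ⟨F, hF, hlt⟩

/-- RH-FREE. **`n ↦ μ_n(T)` is non-increasing.** [cite: Connes1994, Chap. IV §2.α] -/
theorem approxNumber_antitone (T : E →L[𝕜] E) : Antitone (approxNumber T) := by
  intro m n hmn
  refine csInf_le_csInf (approxSet_bddBelow T n) (approxSet_nonempty T m) ?_
  rintro r ⟨F, hF, rfl⟩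
  exact ⟨F, hF.trans (by exact_mod_cast hmn), rfl⟩

/-- RH-FREE. **Subadditivity `μ_{m+n}(S + T) ≤ μ_m(S) + μ_n(T)`** (ranks add under sums).
[cite: Connes1994, Chap. IV §2.α] -/
theorem approxNumber_add_le (S T : E →L[𝕜] E) (m n : ℕ) :
    approxNumber (S + T) (m + n) ≤ approxNumber S m + approxNumber T n := by
  refine le_of_forall_pos_lt_add fun ε hε => ?_
  obtain ⟨F, hF, hFS⟩ := exists_rank_le_norm_sub_lt S m (half_pos hε)
  obtain ⟨G, hG, hGT⟩ := exists_rank_le_norm_sub_lt T n (half_pos hε)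
  have hrank : Module.rank 𝕜 (LinearMap.range ((F + G : E →L[𝕜] E) : E →ₗ[𝕜] E)) ≤ (m + n : ℕ) := by
    rw [ContinuousLinearMap.toLinearMap_add]
    calc Module.rank 𝕜 (LinearMap.range ((F : E →ₗ[𝕜] E) + (G : E →ₗ[𝕜] E)))
        ≤ Module.rank 𝕜 (LinearMap.range (F : E →ₗ[𝕜] E)) +
            Module.rank 𝕜 (LinearMap.range (G : E →ₗ[𝕜] E)) := LinearMap.rank_add_le _ _
      _ ≤ (m : Cardinal) + (n : Cardinal) := add_le_add hF hG
      _ = ((m + n : ℕ) : Cardinal) := by norm_cast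
  calc approxNumber (S + T) (m + n) ≤ ‖(S + T) - (F + G)‖ := approxNumber_le_of_rank_le _ _ hrank
    _ = ‖(S - F) + (T - G)‖ := by congr 1; abel
    _ ≤ ‖S - F‖ + ‖T - G‖ := norm_add_le _ _
    _ < approxNumber S m + approxNumber T n + ε := by linarith

/-- RH-FREE. **The two-sided ideal inequality `μ_n(U T V) ≤ ‖U‖ μ_n(T) ‖V‖.**
[cite: Connes1994, Chap. IV §2.α; ConnesConsani2021, App. D p. 33 (arXiv chunk p0033:L24–36)] -/
theorem approxNumber_comp_le (U T V : E →L[𝕜] E) (n : ℕ) :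
    approxNumber (U.comp (T.comp V)) n ≤ ‖U‖ * approxNumber T n * ‖V‖ := by
  refine le_of_forall_gt_imp_ge_of_dense fun c hc => ?_
  -- choose `ε` with `‖U‖ ‖V‖ ε ≤ c − ‖U‖ μ_n(T) ‖V‖`
  set ε : ℝ := (c - ‖U‖ * approxNumber T n * ‖V‖) / (‖U‖ * ‖V‖ + 1) with hε_def
  have hUV : 0 ≤ ‖U‖ * ‖V‖ := by positivity
  have hε : 0 < ε := div_pos (by linarith) (by linarith)
  obtain ⟨F, hF, hFT⟩ := exists_rank_le_norm_sub_lt T n hε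
  have hrank : Module.rank 𝕜 (LinearMap.range ((U.comp (F.comp V) : E →L[𝕜] E) : E →ₗ[𝕜] E)) ≤ n := by
    have hcoe : ((U.comp (F.comp V) : E →L[𝕜] E) : E →ₗ[𝕜] E) =
        (U : E →ₗ[𝕜] E).comp ((F : E →ₗ[𝕜] E).comp (V : E →ₗ[𝕜] E)) := rfl
    rw [hcoe]
    exact (LinearMap.rank_comp_le_right _ _).trans ((LinearMap.rank_comp_le_left _ _).trans hF)
  have hdiff : U.comp (T.comp V) - U.comp (F.comp V) = U.comp ((T - F).comp V) := by
    ext x; simp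
  calc approxNumber (U.comp (T.comp V)) n ≤ ‖U.comp (T.comp V) - U.comp (F.comp V)‖ :=
        approxNumber_le_of_rank_le _ _ hrank
    _ = ‖U.comp ((T - F).comp V)‖ := by rw [hdiff]
    _ ≤ ‖U‖ * ‖T - F‖ * ‖V‖ := by
        refine (ContinuousLinearMap.opNorm_comp_le _ _).trans ?_
        rw [mul_assoc]
        exact mul_le_mul_of_nonneg_left (ContinuousLinearMap.opNorm_comp_le _ _) (norm_nonneg _)
    _ ≤ ‖U‖ * (approxNumber T n + ε) * ‖V‖ := by gcongr
    _ = ‖U‖ * approxNumber T n * ‖V‖ + (‖U‖ * ‖V‖) * ε := by ring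
    _ ≤ ‖U‖ * approxNumber T n * ‖V‖ + (c - ‖U‖ * approxNumber T n * ‖V‖) := by
        have hkey : ‖U‖ * ‖V‖ * ε ≤ c - ‖U‖ * approxNumber T n * ‖V‖ := by
          rw [hε_def, ← mul_div_assoc, div_le_iff₀ (by linarith)]
          nlinarith
        linarith
    _ = c := by ring

/-- RH-FREE. **Unitary invariance**: `μ_n(U T U⁻¹) = μ_n(T)` for a surjective linear isometry `U`.
[cite: Connes1994, Chap. IV §2.α] -/
theorem approxNumber_conj_linearIsometryEquiv (U : E ≃ₗᵢ[𝕜] E) (T : E →L[𝕜] E) (n : ℕ) :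
    approxNumber ((U : E →L[𝕜] E).comp (T.comp (U.symm : E →L[𝕜] E))) n = approxNumber T n := by
  -- both inequalities from the two-sided ideal inequality and `‖U‖, ‖U⁻¹‖ ≤ 1`
  have h1 := approxNumber_comp_le (U : E →L[𝕜] E) T (U.symm : E →L[𝕜] E) n
  have h2 := approxNumber_comp_le (U.symm : E →L[𝕜] E)
    ((U : E →L[𝕜] E).comp (T.comp (U.symm : E →L[𝕜] E))) (U : E →L[𝕜] E) n
  have hback : (U.symm : E →L[𝕜] E).comp
      (((U : E →L[𝕜] E).comp (T.comp (U.symm : E →L[𝕜] E))).comp (U : E →L[𝕜] E)) = T := by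
    ext x; simp
  rw [hback] at h2
  have hU : ‖(U : E →L[𝕜] E)‖ ≤ 1 := U.toLinearIsometry.norm_toContinuousLinearMap_le
  have hUs : ‖(U.symm : E →L[𝕜] E)‖ ≤ 1 := U.symm.toLinearIsometry.norm_toContinuousLinearMap_le
  have ha := approxNumber_nonneg' T n
  have hb := approxNumber_nonneg' ((U : E →L[𝕜] E).comp (T.comp (U.symm : E →L[𝕜] E))) n
  apply le_antisymm
  · calc _ ≤ ‖(U : E →L[𝕜] E)‖ * approxNumber T n * ‖(U.symm : E →L[𝕜] E)‖ := h1
      _ ≤ 1 * approxNumber T n * 1 := by gcongr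
      _ = approxNumber T n := by ring
  · calc approxNumber T n
        ≤ ‖(U.symm : E →L[𝕜] E)‖ *
            approxNumber ((U : E →L[𝕜] E).comp (T.comp (U.symm : E →L[𝕜] E))) n *
            ‖(U : E →L[𝕜] E)‖ := h2
      _ ≤ 1 * approxNumber ((U : E →L[𝕜] E).comp (T.comp (U.symm : E →L[𝕜] E))) n * 1 := by gcongr
      _ = _ := by ring

/-! ### Infinitesimals of infinite order: closure properties -/

/-- RH-FREE. The constants in `IsInfiniteOrder` are automatically `≥ 0` (take `n = 0`). [folklore] -/
private theorem nonneg_of_bound {T : E →L[𝕜] E} {k : ℕ} {C : ℝ}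
    (hC : ∀ n : ℕ, approxNumber T n * ((n : ℝ) + 1) ^ k ≤ C) : 0 ≤ C :=
  (mul_nonneg (approxNumber_nonneg' T 0) (by positivity)).trans (hC 0)

/-- RH-FREE. **Criterion by explicit approximants**: if for every `k` there are finite-rank `F_n`
(rank `≤ n`) with `‖T − F_n‖(n+1)^k ≤ C_k`, then `T` is of infinite order.
[cite: ConnesConsani2021, App. D p. 33 (arXiv chunk p0033:L20); Connes1994, Chap. IV §2.α] -/
theorem IsInfiniteOrder.of_approx {T : E →L[𝕜] E}
    (h : ∀ k : ℕ, ∃ C : ℝ, ∀ n : ℕ, ∃ F : E →L[𝕜] E,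
      Module.rank 𝕜 (LinearMap.range (F : E →ₗ[𝕜] E)) ≤ n ∧ ‖T - F‖ * ((n : ℝ) + 1) ^ k ≤ C) :
    IsInfiniteOrder T := by
  intro k
  obtain ⟨C, hC⟩ := h k
  refine ⟨C, fun n => ?_⟩
  obtain ⟨F, hF, hle⟩ := hC n
  exact (mul_le_mul_of_nonneg_right (approxNumber_le_of_rank_le T F hF) (by positivity)).trans hle

/-- RH-FREE. `0` is of infinite order. [cite: Connes1994, Chap. IV §2.α] -/
theorem isInfiniteOrder_zero : IsInfiniteOrder (0 : E →L[𝕜] E) := by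
  intro k
  refine ⟨0, fun n => ?_⟩
  have h := approxNumber_le_opNorm (0 : E →L[𝕜] E) n
  rw [norm_zero] at h
  have h0 : approxNumber (0 : E →L[𝕜] E) n = 0 := le_antisymm h (approxNumber_nonneg' _ _)
  rw [h0, zero_mul]

/-- RH-FREE. **A finite-rank operator is of infinite order** (`μ_n(F) = 0` for `n ≥ rank F`).
[cite: Connes1994, Chap. IV §2.α] -/
theorem isInfiniteOrder_of_rank_le {F : E →L[𝕜] E} {N : ℕ}
    (hF : Module.rank 𝕜 (LinearMap.range (F : E →ₗ[𝕜] E)) ≤ N) : IsInfiniteOrder F := by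
  intro k
  refine ⟨‖F‖ * ((N : ℝ) + 1) ^ k, fun n => ?_⟩
  rcases lt_or_ge n N with hn | hn
  · have hle : (n : ℝ) + 1 ≤ (N : ℝ) + 1 := by
      have : (n : ℝ) ≤ N := by exact_mod_cast hn.le
      linarith
    exact mul_le_mul (approxNumber_le_opNorm F n) (pow_le_pow_left₀ (by positivity) hle k)
      (by positivity) (norm_nonneg _)
  · have h0 : approxNumber F n = 0 := by
      refine le_antisymm ?_ (approxNumber_nonneg' _ _)
      simpa using approxNumber_le_of_rank_le F F (hF.trans (by exact_mod_cast hn))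
    rw [h0, zero_mul]
    positivity

/-- RH-FREE. **Two-sided ideal property**: `U T V` is of infinite order when `T` is.
[cite: Connes1994, Chap. IV §2.α; ConnesConsani2021, App. D p. 33 (arXiv chunk p0033:L24–36)] -/
theorem IsInfiniteOrder.comp {T : E →L[𝕜] E} (hT : IsInfiniteOrder T) (U V : E →L[𝕜] E) :
    IsInfiniteOrder (U.comp (T.comp V)) := by
  intro k
  obtain ⟨C, hC⟩ := hT k
  refine ⟨‖U‖ * ‖V‖ * C, fun n => ?_⟩
  calc approxNumber (U.comp (T.comp V)) n * ((n : ℝ) + 1) ^ k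
      ≤ (‖U‖ * approxNumber T n * ‖V‖) * ((n : ℝ) + 1) ^ k :=
        mul_le_mul_of_nonneg_right (approxNumber_comp_le U T V n) (by positivity)
    _ = ‖U‖ * ‖V‖ * (approxNumber T n * ((n : ℝ) + 1) ^ k) := by ring
    _ ≤ ‖U‖ * ‖V‖ * C := mul_le_mul_of_nonneg_left (hC n) (by positivity)

/-- RH-FREE. Left ideal property. [cite: Connes1994, Chap. IV §2.α] -/
theorem IsInfiniteOrder.comp_left {T : E →L[𝕜] E} (hT : IsInfiniteOrder T) (U : E →L[𝕜] E) :
    IsInfiniteOrder (U.comp T) := by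
  simpa using hT.comp U (ContinuousLinearMap.id 𝕜 E)

/-- RH-FREE. Right ideal property. [cite: Connes1994, Chap. IV §2.α] -/
theorem IsInfiniteOrder.comp_right {T : E →L[𝕜] E} (hT : IsInfiniteOrder T) (V : E →L[𝕜] E) :
    IsInfiniteOrder (T.comp V) := by
  simpa using hT.comp (ContinuousLinearMap.id 𝕜 E) V

/-- RH-FREE. Scalar multiples. [cite: Connes1994, Chap. IV §2.α] -/
theorem IsInfiniteOrder.smul {T : E →L[𝕜] E} (hT : IsInfiniteOrder T) (c : 𝕜) :
    IsInfiniteOrder (c • T) := by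
  have h := hT.comp_left (c • ContinuousLinearMap.id 𝕜 E)
  have hc : (c • ContinuousLinearMap.id 𝕜 E).comp T = c • T := by ext x; simp
  rwa [hc] at h

/-- RH-FREE. **Sums**: `S + T` is of infinite order when `S` and `T` are
(`μ_{2n}(S+T) ≤ μ_n(S) + μ_n(T)` and `(N+1)^k ≤ 2^k(⌊N/2⌋+1)^k`). [cite: Connes1994, Chap. IV §2.α] -/
theorem IsInfiniteOrder.add {S T : E →L[𝕜] E} (hS : IsInfiniteOrder S) (hT : IsInfiniteOrder T) :
    IsInfiniteOrder (S + T) := by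
  intro k
  obtain ⟨CS, hCS⟩ := hS k
  obtain ⟨CT, hCT⟩ := hT k
  refine ⟨2 ^ k * (CS + CT), fun N => ?_⟩
  set n := N / 2 with hn
  have hN : approxNumber (S + T) N ≤ approxNumber S n + approxNumber T n :=
    (approxNumber_antitone (S + T) (by omega : n + n ≤ N)).trans (approxNumber_add_le S T n n)
  have hpow : ((N : ℝ) + 1) ^ k ≤ 2 ^ k * ((n : ℝ) + 1) ^ k := by
    rw [← mul_pow]
    gcongr
    have : (N : ℝ) ≤ 2 * n + 1 := by exact_mod_cast (by omega : N ≤ 2 * n + 1)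
    linarith
  have ha := approxNumber_nonneg' (S + T) N
  have hsum : 0 ≤ approxNumber S n + approxNumber T n :=
    add_nonneg (approxNumber_nonneg' _ _) (approxNumber_nonneg' _ _)
  calc approxNumber (S + T) N * ((N : ℝ) + 1) ^ k
      ≤ (approxNumber S n + approxNumber T n) * (2 ^ k * ((n : ℝ) + 1) ^ k) := by gcongr
    _ = 2 ^ k * (approxNumber S n * ((n : ℝ) + 1) ^ k + approxNumber T n * ((n : ℝ) + 1) ^ k) := by
        ring
    _ ≤ 2 ^ k * (CS + CT) := by gcongr; exacts [hCS n, hCT n]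

/-- RH-FREE. Differences. [cite: Connes1994, Chap. IV §2.α] -/
theorem IsInfiniteOrder.sub {S T : E →L[𝕜] E} (hS : IsInfiniteOrder S) (hT : IsInfiniteOrder T) :
    IsInfiniteOrder (S - T) := by
  rw [sub_eq_add_neg, ← neg_one_smul 𝕜 T]
  exact hS.add (hT.smul (-1))

/-- RH-FREE. **Unitary invariance of "infinite order"**: `U T U⁻¹` is of infinite order iff `T` is
(`U` a surjective linear isometry, e.g. the Fourier–Plancherel transform on `L²`).
[cite: Connes1994, Chap. IV §2.α; ConnesConsani2021, App. D p. 33 (arXiv chunk p0033:L24: "`[H,f] = 𝔽_C[1_P, K]𝔽_C⁻¹`")] -/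
theorem isInfiniteOrder_conj_iff (U : E ≃ₗᵢ[𝕜] E) (T : E →L[𝕜] E) :
    IsInfiniteOrder ((U : E →L[𝕜] E).comp (T.comp (U.symm : E →L[𝕜] E))) ↔ IsInfiniteOrder T := by
  constructor
  · intro h
    have h' := h.comp (U.symm : E →L[𝕜] E) (U : E →L[𝕜] E)
    have hback : (U.symm : E →L[𝕜] E).comp
        (((U : E →L[𝕜] E).comp (T.comp (U.symm : E →L[𝕜] E))).comp (U : E →L[𝕜] E)) = T := by
      ext x; simp
    rwa [hback] at h'
  · intro h
    exact h.comp _ _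

end ApproxNumberCalculus

end Literature.NumberTheory.ConnesConsani2021
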